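import Summits.ResolutionOfSingularities.ResolutionOfSingularities.Theorems.PAlterationPalterationThesisPerfectTransfer
import Summits.ResolutionOfSingularities.ResolutionOfSingularities.Theorems.PAlterationPalterationThesisStubAtomsOfPerfectRes
import Summits.ResolutionOfSingularities.ResolutionOfSingularities.Theorems.ValuativePatchingReductions
import Summits.ResolutionOfSingularities.ResolutionOfSingularities.Theses.Descent
import HarnessLib

/-!
# Crux `PalterationThesis` (stmt-ResolutionOfSingularities-0552), line `Sketch`: the hypothesis-minimal display
# — local uniformization and two-model patching over PERFECT fields

Line lead c6 (prover-line-stmt-ResolutionOfSingularities-0552-c6-0), 2026-08-17; route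
`ResolutionOfSingularities/pAlteration`, crux `PalterationThesis = ∀ p, PIAlt_p ∧ PICover_p`
(⟺ summit, `palterationThesis_iff_resolutionOfSingularities`).

Line `Sketch` transfers the crux to perfect ground fields
(`palterationThesis_iff_perfect_and_descent`: the crux ⟺ (PIAlt ∧ PICover over every perfect
field of prime characteristic) ∧ `DescentPerfectToAll`, and over a perfect `K`,
PIAlt_K ∧ PICover_K ⟺ resolution of every reduced separated `K`-scheme of finite type,
`pialtOver_and_picoverOver_iff_perfectField`). The successive skeletons decomposed resolution
over `K` further: rev. c3–c5 into Temkin's inseparable local uniformization, one-step radicial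
descent of local uniformization (⟸ item 0641) and two-model patching; rev. c6 into Zariski's
existence of regular models and two-model patching. ALL of these factor through the single
fieldwise equivalence recorded here, the fieldwise form of the landed
`resolutionInChar_iff_twoModelPatching_and_lu`:

* `resOver_iff_luAt_and_tmpAt` — over ANY field `K`: resolution of every reduced separated
  `K`-scheme of finite type ⟺ (local uniformization of every valuation of every finitely
  generated `F/K`) ∧ (two-model patching of proper models over `K`);
* `palterationThesis_iff_luPerfect_tmpPerfect_and_descent` — the crux ⟺ (LU_K ∧ TMP_K for every
  perfect `K` of every prime characteristic) ∧ `DescentPerfectToAll` (item stmt-0549);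
* `palterationThesis_iff_luPerfect_tmpPerfect_and_picover` — the same with item stmt-0554
  `Picover` in place of stmt-0549 (equivalent under resolution over perfect fields,
  `descentPerfectToAll_iff_picover_of_perfectRes`);
* `resolutionOfSingularities_iff_luPerfect_tmpPerfect_and_picover` — the summit in the same form.

So the residues of line `Sketch` in their weakest form are: LOCAL UNIFORMIZATION OVER PERFECT
FIELDS (Zariski–Kuhlmann; open in transcendence degree ≥ 4; implied by each of the rev. c3–c6
first slots), TWO-MODEL PATCHING OVER PERFECT FIELDS (Zariski–Piltant; crux 0642's core), and
`Picover` (item 0554) or `DescentPerfectToAll` (item 0549 ⟸ 0554). Nothing here is new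
mathematics; every ingredient was in the tree.
-/

set_option linter.dupNamespace false

noncomputable section

open CategoryTheory AlgebraicGeometry
open Literature.AlgebraicGeometry.Resolution
open Summit.ResolutionOfSingularities.ResolutionOfSingularities.Theses.PAlteration
open Summit.ResolutionOfSingularities.ResolutionOfSingularities.Theses.Descent (DescentPerfectToAll)
open Summit.ResolutionOfSingularities.ResolutionOfSingularities.Theorems.PalterationThesis.PerfectTransfer
open Summit.ResolutionOfSingularities.ResolutionOfSingularities.Theorems.PalterationThesis.PerfectAtoms
  (isLocallyUniformizable_of_resOver)

namespace Summit.ResolutionOfSingularities.ResolutionOfSingularities.Theorems.PalterationThesis.ZariskiPerfect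

/-- **Over ANY field `K`: resolution of every reduced separated `K`-scheme of finite type ⟺
local uniformization over `K` ∧ two-model patching over `K`** — the fieldwise form of
`resolutionInChar_iff_twoModelPatching_and_lu` (`→`: the valuative criterion on a resolved
affine model, `isLocallyUniformizable_of_resOver`, and resolve the join of the two models as in
`ProperModel.twoModelPatching_of_resolutionInChar`; `←`: Zariski's resolving system,
`resolutionOverUpToDim_of_properPatching_of_lu`, in the dimension bound
`exists_topologicalKrullDim_le_of_locallyOfFiniteType`). [cite: Piltant2013, Prop. 5.1 and Cor. 5.7] -/
theorem resOver_iff_luAt_and_tmpAt (K : Type) [Field K] :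
    (∀ (X : Scheme.{0}) (f : X ⟶ Spec (.of K)),
      IsSeparated f → LocallyOfFiniteType f → QuasiCompact f → IsReduced X →
      Scheme.HasResolution X) ↔
    (∀ (F : Type) [Field F] [Algebra K F], (⊤ : IntermediateField K F).FG →
      ∀ O : ValuationSubring F, (∀ c : K, algebraMap K F c ∈ O) → IsLocallyUniformizable K F O) ∧
    (∀ (F : Type) [Field F] [Algebra K F] [Algebra.EssFiniteType K F],
      ∀ M₁ M₂ : ProperModel K F,
        ∃ (N : ProperModel K F) (φ₁ : N.Hom M₁) (φ₂ : N.Hom M₂), φ₁.RegLe ∧ φ₂.RegLe) := by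
  constructor
  · intro hres
    refine ⟨fun F _ _ hFfg O hO => isLocallyUniformizable_of_resOver hres F hFfg O hO,
      fun F _ _ _ M₁ M₂ => ?_⟩
    -- resolve the join (as in `ProperModel.twoModelPatching_of_resolutionInChar`)
    obtain ⟨N, φ, hN⟩ := (ProperModel.join M₁ M₂).exists_hom_isRegular_of_hasResolution
      (hres _ (ProperModel.join M₁ M₂).π inferInstance inferInstance inferInstance inferInstance)
    exact ⟨N, φ.comp (ProperModel.joinFst M₁ M₂), φ.comp (ProperModel.joinSnd M₁ M₂),
      fun y _ => hN y, fun y _ => hN y⟩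
  · rintro ⟨hLU, hZ⟩ X f hs hl hq hr
    haveI := hl
    haveI := hq
    haveI : CompactSpace X := QuasiCompact.compactSpace_of_compactSpace f
    obtain ⟨d, hd⟩ := exists_topologicalKrullDim_le_of_locallyOfFiniteType f
    exact resolutionOverUpToDim_of_properPatching_of_lu hZ
      (fun F _ _ hFfg O hO => hLU F hFfg O hO) d X f hs hl hq hr hd

/-- **The crux ⟺ (local uniformization ∧ two-model patching) over the perfect fields of every
prime characteristic ∧ `DescentPerfectToAll`** — the hypothesis-minimal form of the line's
displays (LU_K ⟸ Temkin_K ∧ RRLU1_K of rev. c3–c5; LU_K ⟸ RegModel_K of rev. c6).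
[cite: Piltant2013, Prop. 5.1 and Cor. 5.7] -/
theorem palterationThesis_iff_luPerfect_tmpPerfect_and_descent :
    PalterationThesis ↔
      (∀ p : ℕ, p.Prime → ∀ (K : Type) [Field K] [CharP K p] [PerfectField K],
        (∀ (F : Type) [Field F] [Algebra K F], (⊤ : IntermediateField K F).FG →
          ∀ O : ValuationSubring F, (∀ c : K, algebraMap K F c ∈ O) →
            IsLocallyUniformizable K F O) ∧
        (∀ (F : Type) [Field F] [Algebra K F] [Algebra.EssFiniteType K F],
          ∀ M₁ M₂ : ProperModel K F,
            ∃ (N : ProperModel K F) (φ₁ : N.Hom M₁) (φ₂ : N.Hom M₂), φ₁.RegLe ∧ φ₂.RegLe)) ∧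
      DescentPerfectToAll := by
  rw [palterationThesis_iff_perfect_and_descent]
  refine and_congr_left fun _ => forall_congr' fun p => forall_congr' fun hp => ?_
  refine forall_congr' fun K => forall_congr' fun _ => forall_congr' fun _ =>
    forall_congr' fun _ => ?_
  rw [pialtOver_and_picoverOver_iff_perfectField p hp K]
  exact resOver_iff_luAt_and_tmpAt K

/-- **The crux ⟺ (local uniformization ∧ two-model patching) over perfect fields ∧ `Picover`**
(item stmt-0554 in place of stmt-0549: under resolution over perfect fields the two are
equivalent, `descentPerfectToAll_iff_picover_of_perfectRes`).
[cite: Piltant2013, Prop. 5.1 and Cor. 5.7] -/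
theorem palterationThesis_iff_luPerfect_tmpPerfect_and_picover :
    PalterationThesis ↔
      (∀ p : ℕ, p.Prime → ∀ (K : Type) [Field K] [CharP K p] [PerfectField K],
        (∀ (F : Type) [Field F] [Algebra K F], (⊤ : IntermediateField K F).FG →
          ∀ O : ValuationSubring F, (∀ c : K, algebraMap K F c ∈ O) →
            IsLocallyUniformizable K F O) ∧
        (∀ (F : Type) [Field F] [Algebra K F] [Algebra.EssFiniteType K F],
          ∀ M₁ M₂ : ProperModel K F,
            ∃ (N : ProperModel K F) (φ₁ : N.Hom M₁) (φ₂ : N.Hom M₂), φ₁.RegLe ∧ φ₂.RegLe)) ∧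
      Picover := by
  constructor
  · intro h
    exact ⟨(palterationThesis_iff_luPerfect_tmpPerfect_and_descent.mp h).1,
      picover_of_palterationThesis h⟩
  · rintro ⟨hZ, hPc⟩
    have hperf : ∀ p : ℕ, p.Prime → ∀ (K : Type) [Field K] [CharP K p] [PerfectField K]
        (X : Scheme.{0}) (f : X ⟶ Spec (.of K)),
        IsSeparated f → LocallyOfFiniteType f → QuasiCompact f → IsReduced X →
        Scheme.HasResolution X := fun p hp K _ _ _ =>
      (resOver_iff_luAt_and_tmpAt K).mpr (hZ p hp K)
    exact palterationThesis_iff_luPerfect_tmpPerfect_and_descent.mpr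
      ⟨hZ, (descentPerfectToAll_iff_picover_of_perfectRes hperf).mpr hPc⟩

/-- **Resolution of singularities in positive characteristic ⟺ (local uniformization ∧
two-model patching) over perfect fields ∧ `Picover`.** [cite: Piltant2013, Prop. 5.1 and Cor. 5.7] -/
theorem resolutionOfSingularities_iff_luPerfect_tmpPerfect_and_picover :
    _root_.ResolutionOfSingularities ↔
      (∀ p : ℕ, p.Prime → ∀ (K : Type) [Field K] [CharP K p] [PerfectField K],
        (∀ (F : Type) [Field F] [Algebra K F], (⊤ : IntermediateField K F).FG →
          ∀ O : ValuationSubring F, (∀ c : K, algebraMap K F c ∈ O) →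
            IsLocallyUniformizable K F O) ∧
        (∀ (F : Type) [Field F] [Algebra K F] [Algebra.EssFiniteType K F],
          ∀ M₁ M₂ : ProperModel K F,
            ∃ (N : ProperModel K F) (φ₁ : N.Hom M₁) (φ₂ : N.Hom M₂), φ₁.RegLe ∧ φ₂.RegLe)) ∧
      Picover :=
  palterationThesis_iff_resolutionOfSingularities.symm.trans
    palterationThesis_iff_luPerfect_tmpPerfect_and_picover

end Summit.ResolutionOfSingularities.ResolutionOfSingularities.Theorems.PalterationThesis.ZariskiPerfect

end
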